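import Summits.HodgeConjecture.HodgeConjecture.Theorems.K2E3GL3PrincipalSeriesRegular
import Summits.HodgeConjecture.HodgeConjecture.Theorems.K2E3GL3EmbeddingOfWeight
import Summits.HodgeConjecture.HodgeConjecture.Theorems.K2E3GL3WeightOneUniqueness
import Summits.HodgeConjecture.HodgeConjecture.Theorems.K2E3GL3PrincipalSeriesExhaustion
import Summits.HodgeConjecture.HodgeConjecture.Theorems.K2E3GL3JacquetMultiplicityAdditive
import Summits.HodgeConjecture.HodgeConjecture.Theorems.K2E3GL3StandardModuleEmbedding
import HarnessLib

/-!
# R90-TF · S1 #7 helper — the REGULAR-WEIGHT irreducibility criterion for `GL₃(F)`: a completely reducible `Π ↪ I(θ)`, `θ` regular, is irreducible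

Cell `hodgecm-mathlib`, programme R90-TF, section S1 «Ch10-local», seat R90-C10-p01 (g0); helper for the socket S1#7
`stub_S1_split_parabolicInd_irreducible_of_unitary` (`Cruxes/H413/Lines/R90_S1_SplitLocalPacketsB.lean`), consumed by
`Theorems/R90S1SplitInducedIrreducibleBox`.  THEOREMS ONLY (one public theorem); no definition, no named fact, no `sorry`.

THE MATHEMATICS ([BernsteinZelevinsky1977, Thm. 2.9, Cor. 2.13]; [Casselman1995, Thm. 6.3.5, §6.4]).  Let `θ = (θ₀, θ₁, θ₂)` be pairwise distinct characters of
`F^×` with open kernels, `I(θ) = Ind_B^{GL₃}(θ ⊗ δ_B^{1/2})` (★ K2E3 currency `parabolicIndGL F id (𝟙.twist (tch θ))`).  Then the weight `tch θ` has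
multiplicity ONE in the Jacquet module of `I(θ)` (★ REG `finrank_weightSpace_principalSeries_perm_eq_one`), every non-zero subrepresentation of `I(θ)` carries
it (★ EMB `finrank_weightSpace_ne_zero_of_intertwiningMap_ne_zero`), and multiplicities of disjoint subrepresentations add (★ UNIQ
`finrank_weightSpace_add_le_of_inf_eq_bot`).  Hence a COMPLETELY REDUCIBLE `Π ≠ 0` with an injective intertwining map `Π ↪ I(θ)` is irreducible: a proper
non-zero subrepresentation and its complement would give two disjoint non-zero subrepresentations of `I(θ)`.
HONEST LABEL: HC_CM is proved only modulo the 7 printed citations (2 remaining named inputs: hLiu418 = stmt-HodgeConjecture-24832,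
h413 = stmt-HodgeConjecture-24833) until rung 0 closes; count-neutral helper (`--supports stmt-HodgeConjecture-24833 --as helper`).
-/

set_option autoImplicit false
set_option linter.dupNamespace false

noncomputable section

open MeasureTheory Measure Set Filter Topology
open scoped NNReal ENNReal ComplexConjugate

namespace Summit.HodgeConjecture.HodgeConjecture.R90.S1

open Literature.NumberTheory Literature.NumberTheory.Automorphic

/-! ## §M2 The regular-weight criterion: a completely reducible `Π ↪ I(θ)`, `θ` regular, is irreducible -/

section Regular

open Summit.HodgeConjecture.HodgeConjecture.Cruxes.H413

variable {F : Type} [Field F] [ValuativeRel F] [TopologicalSpace F] [IsNonarchimedeanLocalField F]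

set_option maxHeartbeats 800000 in
/-- **REGULAR-WEIGHT IRREDUCIBILITY CRITERION.**  Let `θ = (θ₀, θ₁, θ₂)` be pairwise DISTINCT characters of `F^×` with open kernels and
`I(θ) = Ind_B^{GL₃}(θ ⊗ δ_B^{1/2})` the principal series (★ K2E3 currency `parabolicIndGL F id (𝟙.twist (tch θ))`).  A COMPLETELY REDUCIBLE
representation `Π ≠ 0` of `GL₃(F)` admitting an injective intertwining map `Π ↪ I(θ)` is IRREDUCIBLE: two disjoint non-zero subrepresentations of
`I(θ)` would both carry the weight `tch θ` (★ EMB `finrank_weightSpace_ne_zero_of_intertwiningMap_ne_zero`), of total multiplicity `≥ 2` (★ UNIQ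
`finrank_weightSpace_add_le_of_inf_eq_bot`), against multiplicity ONE for a regular `θ` (★ REG `finrank_weightSpace_principalSeries_perm_eq_one`).
[cite: BernsteinZelevinsky1977, Thm. 2.9, Cor. 2.13] [cite: Casselman1995, Thm. 6.3.5, §6.4] -/
theorem isIrreducible_of_injective_principalSeries_three_of_regular {V : Type} [AddCommGroup V] [Module ℂ V]
    (piV : Representation ℂ (GL (Fin 3) F) V) [Nontrivial V] (hss : piV.IsSemisimpleRepresentation)
    (θ : Fin 3 → (Fˣ →* ℂˣ)) (hθ : ∀ a, IsOpen (((θ a).ker : Subgroup Fˣ) : Set Fˣ)) (hinj : Function.Injective θ)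
    (ι : piV.IntertwiningMap (Representation.parabolicIndGL F (id : Fin 3 → Fin 3)
      ((Representation.trivial ℂ (Π a : Fin 3, GL {i : Fin 3 // (id : Fin 3 → Fin 3) i = a} F) ℂ).twist
        (∏ a : Fin 3, (θ a).comp (Matrix.GeneralLinearGroup.det.comp
          (Pi.evalMonoidHom (fun a : Fin 3 => GL {i : Fin 3 // (id : Fin 3 → Fin 3) i = a} F) a))))))
    (hι : Function.Injective ι) : piV.IsIrreducible := by
  classical
  have hθ' := K2E3GL3StandardModuleEmbedding.isOpen_ker_tch θ hθ
  haveI hfd := K2E3GL3PrincipalSeriesExhaustion.finiteDimensional_jacquet_principalSeries θ hθ'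
  have hIs := K2E3GL3PrincipalSeriesExhaustion.isSmooth_principalSeries θ
  -- multiplicity one of the weight `tch θ` in `I(θ)`
  have h1 := K2E3GL3PrincipalSeriesRegular.finrank_weightSpace_principalSeries_perm_eq_one θ hθ hinj 1 θ (fun a => rfl)
  -- the lattice of subrepresentations of `piV`
  haveI : Nontrivial (Subrepresentation piV) :=
    ⟨⟨⊥, ⊤, fun h => by
      obtain ⟨v, hv⟩ := exists_ne (0 : V)
      have hv' : v ∈ (⊤ : Subrepresentation piV) := trivial
      rw [← h] at hv'
      exact hv hv'⟩⟩
  refine IsSimpleOrder.mk fun A => ?_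
  by_contra hA
  push Not at hA
  obtain ⟨hA0, hA1⟩ := hA
  obtain ⟨A', hAA'⟩ := exists_isCompl A
  have hA'0 : A' ≠ ⊥ := by
    intro h
    apply hA1
    have := hAA'.sup_eq_top
    rwa [h, sup_bot_eq] at this
  -- images in `I(θ)`
  let img : Subrepresentation piV → Subrepresentation (Representation.parabolicIndGL F (id : Fin 3 → Fin 3)
      ((Representation.trivial ℂ (Π a : Fin 3, GL {i : Fin 3 // (id : Fin 3 → Fin 3) i = a} F) ℂ).twist
        (∏ a : Fin 3, (θ a).comp (Matrix.GeneralLinearGroup.det.comp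
          (Pi.evalMonoidHom (fun a : Fin 3 => GL {i : Fin 3 // (id : Fin 3 → Fin 3) i = a} F) a))))) := fun C =>
    ⟨C.toSubmodule.map ι.toLinearMap, by
      rintro g _ ⟨a, ha, rfl⟩
      refine ⟨piV g a, C.apply_mem_toSubmodule g ha, ?_⟩
      exact LinearMap.congr_fun (ι.isIntertwining' g) a⟩
  have himg_ne : ∀ C : Subrepresentation piV, C ≠ ⊥ → img C ≠ ⊥ := by
    intro C hC h
    apply hC
    apply Subrepresentation.toSubmodule_injective
    change C.toSubmodule = ⊥
    rw [eq_bot_iff]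
    intro a ha
    have : ι.toLinearMap a ∈ (img C).toSubmodule := ⟨a, ha, rfl⟩
    rw [h] at this
    have h0 : ι a = 0 := this
    exact (hι (h0.trans (map_zero ι).symm) : a = 0)
  have hinf : img A ⊓ img A' = ⊥ := by
    apply Subrepresentation.toSubmodule_injective
    change (img A ⊓ img A').toSubmodule = ⊥
    rw [Subrepresentation.toSubmodule_inf, eq_bot_iff]
    rintro x ⟨⟨a, ha, rfl⟩, ⟨a', ha', haa'⟩⟩
    have : a' = a := hι haa'
    subst this
    have hmem : a' ∈ A ⊓ A' := ⟨ha, ha'⟩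
    rw [hAA'.inf_eq_bot] at hmem
    have : a' = 0 := hmem
    rw [this, map_zero]
    trivial
  -- each image carries the weight `tch θ`
  have hwt : ∀ C : Subrepresentation piV, C ≠ ⊥ →
      Module.finrank ℂ ↥(⨅ m, Module.End.maxGenEigenspace (Representation.normalizedJacquetGL F (id : Fin 3 → Fin 3) (img C).toRepresentation m)
        ((((∏ a : Fin 3, (θ a).comp (Matrix.GeneralLinearGroup.det.comp
          (Pi.evalMonoidHom (fun a : Fin 3 => GL {i : Fin 3 // (id : Fin 3 → Fin 3) i = a} F) a))) m : ℂˣ) : ℂ))) ≠ 0 := by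
    intro C hC
    haveI := K2E3GL3JacquetMultiplicityAdditive.finiteDimensional_jacquet_subrepresentation _ monotone_id hIs (img C)
    let incl : (img C).toRepresentation.IntertwiningMap (Representation.parabolicIndGL F (id : Fin 3 → Fin 3)
      ((Representation.trivial ℂ (Π a : Fin 3, GL {i : Fin 3 // (id : Fin 3 → Fin 3) i = a} F) ℂ).twist
        (∏ a : Fin 3, (θ a).comp (Matrix.GeneralLinearGroup.det.comp
          (Pi.evalMonoidHom (fun a : Fin 3 => GL {i : Fin 3 // (id : Fin 3 → Fin 3) i = a} F) a))))) :=
      { toLinearMap := (img C).toSubmodule.subtype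
        isIntertwining' := fun g => LinearMap.ext fun _ => rfl }
    have hincl : incl ≠ 0 := by
      intro h0
      apply himg_ne C hC
      apply Subrepresentation.toSubmodule_injective
      change (img C).toSubmodule = ⊥
      rw [eq_bot_iff]
      intro x hx
      have : incl ⟨x, hx⟩ = 0 := by rw [h0]; rfl
      exact this
    exact K2E3GL3EmbeddingOfWeight.finrank_weightSpace_ne_zero_of_intertwiningMap_ne_zero (img C).toRepresentation
      (hIs.toRepresentation (img C)) _ incl hincl
  have hadd := K2E3GL3WeightOneUniqueness.finrank_weightSpace_add_le_of_inf_eq_bot _ hIs hinf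
    (fun m => (((∏ a : Fin 3, (θ a).comp (Matrix.GeneralLinearGroup.det.comp
      (Pi.evalMonoidHom (fun a : Fin 3 => GL {i : Fin 3 // (id : Fin 3 → Fin 3) i = a} F) a))) m : ℂˣ) : ℂ))
  have hp1 := Nat.pos_of_ne_zero (hwt A hA0)
  have hp2 := Nat.pos_of_ne_zero (hwt A' hA'0)
  have h2 := hadd.trans (le_of_eq h1)
  exact absurd h2 (not_le.2 (Nat.lt_of_lt_of_le one_lt_two (Nat.add_le_add hp1 hp2)))

end Regular


end Summit.HodgeConjecture.HodgeConjecture.R90.S1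

end
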